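import Mathlib.AlgebraicGeometry.IdealSheaf.Basic
import Mathlib.AlgebraicGeometry.Noetherian
import Mathlib.RingTheory.Finiteness.Ideal
import Mathlib.Data.DFinsupp.WellFounded
import HarnessLib

/-!
# Ideal sheaves on a Noetherian scheme: finite generation, the ascending chain condition, radicals

For a quasi-compact, locally Noetherian scheme `X` and ideal sheaves in Mathlib's affine-local form
`X.IdealSheafData`:

* `exists_finite_affineOpens_iSup_eq_top` — a finite family of affine opens covering `X`;
* `IdealSheafData.fg_ideal` — the affine components `𝒥(V)` are finitely generated;
* `IdealSheafData.wellFoundedGT` — **the ideal sheaves of `X` satisfy the ascending chain condition**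
  (an ideal sheaf is determined by its components on a finite affine covering,
  Mathlib `IdealSheafData.ext_of_iSup_eq_top`, which lie in finitely many Noetherian lattices); this is
  the Noetherian induction on closed subschemes used in dévissage arguments (Görtz–Wedhorn I, Lemma
  12.63; Hartshorne II Ex. 3.16 / Prop. 3.2);
* `IdealSheafData.exists_radical_pow_le` — **some power of the radical lies in the ideal**:
  `(√𝒥)ⁿ ≤ 𝒥` (Noetherian rings, Mathlib `Ideal.exists_pow_le_of_le_radical_of_fg`, uniformly on a finite
  affine covering).

Everything is proved; no named facts. Mathlib searched (pin v4.32): `IsLocallyNoetherian.component_noetherian`,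
`IdealSheafData.ext_of_iSup_eq_top`, `le_of_iSup_eq_top`, `radical_ideal`, `ideal_pow`,
`Pi.wellFoundedLT`, `Ideal.exists_pow_le_of_le_radical_of_fg` (used); Mathlib has no chain condition
for `IdealSheafData`.

## References

* U. Görtz, T. Wedhorn, *Algebraic Geometry I: Schemes*, 2nd ed. (2020): Lemma 12.63, proof
  ("By noetherian induction …"), p. 436. [GortzWedhorn2020]
* R. Hartshorne, *Algebraic Geometry*, GTM 52 (1977): II Prop. 3.2 and Ex. 3.16 (Noetherian induction),
  pp. 83, 94. [Hartshorne1977]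
-/

noncomputable section

open CategoryTheory AlgebraicGeometry TopologicalSpace Opposite

universe u

namespace Literature.AlgebraicGeometry.Modules

variable {X : Scheme.{u}}

/-- A quasi-compact scheme has a finite family of affine opens covering it. [folklore] -/
theorem exists_finite_affineOpens_iSup_eq_top [CompactSpace X] :
    ∃ t : Finset X.affineOpens, ⨆ V : t, ((V : X.affineOpens) : X.Opens) = ⊤ := by
  classical
  obtain ⟨t, ht⟩ := isCompact_univ.elim_finite_subcover (fun V : X.affineOpens => ((V : X.Opens) : Set X))
    (fun V => (V : X.Opens).isOpen) fun x _ => by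
      obtain ⟨V, hV, hxV, -⟩ := Opens.isBasis_iff_nbhd.mp X.isBasis_affineOpens (Opens.mem_top x)
      exact Set.mem_iUnion.mpr ⟨⟨V, hV⟩, hxV⟩
  refine ⟨t, top_le_iff.mp fun x _ => ?_⟩
  obtain ⟨V, hV, hxV⟩ := Set.mem_iUnion₂.mp (ht (Set.mem_univ x))
  exact Opens.mem_iSup.mpr ⟨⟨V, hV⟩, hxV⟩

namespace IdealSheafData

/-- The affine components of an ideal sheaf on a locally Noetherian scheme are finitely generated.
[folklore] -/
theorem fg_ideal [IsLocallyNoetherian X] (J : X.IdealSheafData) (V : X.affineOpens) : (J.ideal V).FG :=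
  haveI : IsNoetherianRing Γ(X, (V : X.Opens)) := IsLocallyNoetherian.component_noetherian V
  IsNoetherian.noetherian _

/-- **Ascending chain condition for ideal sheaves on a Noetherian scheme** (Noetherian induction on
closed subschemes). [cite: Hartshorne1977, II Ex. 3.16 (p. 94)] -/
theorem wellFoundedGT [IsLocallyNoetherian X] [CompactSpace X] : WellFoundedGT X.IdealSheafData := by
  classical
  obtain ⟨t, ht⟩ := exists_finite_affineOpens_iSup_eq_top (X := X)
  -- the components on the finite covering, in a product of Noetherian lattices
  let φ : X.IdealSheafData → ∀ V : t, (Ideal Γ(X, ((V : X.affineOpens) : X.Opens)))ᵒᵈ :=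
    fun I V => OrderDual.toDual (I.ideal V)
  haveI : ∀ V : t, IsNoetherianRing Γ(X, ((V : X.affineOpens) : X.Opens)) := fun V =>
    IsLocallyNoetherian.component_noetherian (V : X.affineOpens)
  haveI : ∀ V : t, WellFoundedLT (Ideal Γ(X, ((V : X.affineOpens) : X.Opens)))ᵒᵈ := fun V =>
    inferInstance
  have hwf : WellFounded (fun a b : ∀ V : t, (Ideal Γ(X, ((V : X.affineOpens) : X.Opens)))ᵒᵈ => a < b) :=
    (Pi.wellFoundedLT (α := fun V : t => (Ideal Γ(X, ((V : X.affineOpens) : X.Opens)))ᵒᵈ)).wf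
  refine ⟨Subrelation.wf (r := InvImage (· < ·) φ) ?_ (InvImage.wf φ hwf)⟩
  intro I J hIJ
  -- `I > J` (i.e. `J < I`) gives `φ I < φ J` in the dual order
  change φ I < φ J
  have hle : φ I ≤ φ J := fun V => (show J.ideal V ≤ I.ideal V from hIJ.le V)
  refine lt_of_le_of_ne hle fun h => hIJ.ne' ?_
  exact Scheme.IdealSheafData.ext_of_iSup_eq_top (fun V : t => (V : X.affineOpens)) ht fun V =>
    OrderDual.toDual.injective (congrFun h V)

/-- **Some power of the radical of an ideal sheaf lies in it** (`X` locally Noetherian and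
quasi-compact). [folklore] -/
theorem exists_radical_pow_le [IsLocallyNoetherian X] [CompactSpace X] (J : X.IdealSheafData) :
    ∃ n : ℕ, J.radical ^ n ≤ J := by
  classical
  obtain ⟨t, ht⟩ := exists_finite_affineOpens_iSup_eq_top (X := X)
  have hV : ∀ V : t, ∃ n : ℕ, (J.radical.ideal V) ^ n ≤ J.ideal V := fun V =>
    Ideal.exists_pow_le_of_le_radical_of_fg (by rw [Scheme.IdealSheafData.radical_ideal])
      (fg_ideal J.radical _)
  choose n hn using hV
  refine ⟨Finset.univ.sup n, Scheme.IdealSheafData.le_of_iSup_eq_top (fun V : t => (V : X.affineOpens)) ht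
    fun V => ?_⟩
  rw [Scheme.IdealSheafData.ideal_pow]
  exact (Ideal.pow_le_pow_right (Finset.le_sup (Finset.mem_univ V))).trans (hn V)

end IdealSheafData

end Literature.AlgebraicGeometry.Modules

end
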